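import Summits.BirchSwinnertonDyer.Rank1Residual.Ordinary.Conjectures.KuriharaExactOrderRankOneAt3
import HarnessLib

/-!
# BSD-FREE tests of C-16: at an uncapped level the Kurihara number PREDICTS the floor
# (`F = ord₃ δ̃_ℓ − 2·v_ℓ(P)`), so `ord₃ δ̃_ℓ ≥ 2·v_ℓ(P)` at every non-vanishing level and two uncapped levels
# of one curve must satisfy `ord₁ + 2v₂ = ord₂ + 2v₁` — kill channels that need no `#Ш_an`, no Tamagawa
# number (PROVED implications; C-16 is the HYPOTHESIS)

HONEST FRAMING (cell `b2b-bsdres`, run/shared/lean/b2b/bsd-rank1-residual/, verbatim in every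
file): the goal of the cell is to DELETE the COMBINATION-SHAPED residual classes of the
Birch–Swinnerton-Dyer formula for ALL analytic-rank `≤ 1` elliptic curves over `ℚ` — "full BSD
formula for every rank `≤ 1` curve in class `C`" assembled STRICTLY from published theorems — so
that the rank-`≤ 1` remainder becomes exactly the CONSTRUCTION-SHAPED classes, which are TYPED
(missing-input `Prop`s), NOT attempted. This is not "finishing BSD". Seat `b2b-bsdres-additive-p3`
(typer-designate for the cell conjecture C-16, hyp R-16 (e)). THEOREMS ONLY: implications FROM the typed
conjecture C-16 = hyp §120 C120.1 (`KuriharaExactOrderAt` / `KuriharaExactOrderRankOneAtThree`, sibling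
`KuriharaExactOrderRankOneAt3.lean`), which enters as a HYPOTHESIS everywhere; C-16 is a CONJECTURE
(data-suggested, NEVER theorem); nothing about any curve is asserted, nothing is booked, no mark / label /
count / tier moves; X7 / X8 stay CONSTRUCTION-SHAPED.

## Why this file (for the owner's KILL LETTER K-hyp-4 and the instruments)

K-hyp-4 (hyp §120) retires C-16 by ONE level with `ord₃(δ̃_ℓ mod 3^k) ≠ min(k, FLOOR + 2·v_ℓ(P))`,
`FLOOR = v₃ #Ш_an + v₃ ∏ c_q` — a test that READS `#Ш_an` (an analytic, BSD-side datum). The law has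
consequences that read NO BSD-side datum at all, only Kurihara numbers and point multiplications mod `ℓ`
(`R1-DEPTH-LAW.md` §4 (b): "at a `v ≥ 1` prime, `FLOOR = ord − 2v`: a second, independent certification"):

* §1 (one level): under the law at `(ℓ, k)` with floor `F`, if `δ̃_ℓ ≢ 0 (mod 3^k)` then
  **`F + 2·v_ℓ(P) = ord₃ δ̃_ℓ`** — the floor is PREDICTED by the level (`floor_add_eq_zmodPowOrd_of_ne_zero`);
  hence **`2·v_ℓ(P) ≤ ord₃ δ̃_ℓ`** at every non-vanishing level (`two_mul_localDivExponent_le_zmodPowOrd`) and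
  **a UNIT Kurihara number forces `v_ℓ(P) = 0`** (`localDivExponent_eq_zero_of_isUnit_kuriharaNumber`): a
  `v ≥ 1` cyclic Kolyvagin prime with a unit `δ̃_ℓ` kills the law at that level with no `L`-value input.
* §2 (two levels of ONE curve, same floor `F`, depths `k₁`, `k₂`): both non-vanishing ⟹
  **`ord₁ + 2·v₂ = ord₂ + 2·v₁`** (`zmodPowOrd_add_eq_of_kuriharaExactOrderAt_pair`); contrapositive: two
  non-vanishing levels with `ord₁ + 2v₂ ≠ ord₂ + 2v₁` refute the conjunction of the two level laws.
* §3 (closed sentence): on a curve of C-16's letter, C-16 ⟹ the cross-level identity for every two cyclic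
  Kolyvagin primes with non-vanishing Kurihara numbers (`zmodPowOrd_add_eq_of_kuriharaExactOrderRankOne`,
  `hC` a hypothesis) — so ONE curve of the letter with two such levels violating it would retire C-16 by
  `modus tollens`: the BSD-free form of K-hyp-4, left to the owner's pen (no `¬ C-16` declaration is made
  here; nothing suggests such a curve exists — the rounds of record are `6 335 / 6 335`).

References: hyp `SHARPENED-CONJECTURES.md` §120 (C120.1, K-hyp-4); additive-p3 `R1-DEPTH-LAW.md` §4 (b);
C.-H. Kim, Amer. J. Math. 148 (2026) = arXiv:2203.12159, §1.4.3 [Kim2022StructureSelmer].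
-/

noncomputable section

open scoped Classical MatrixGroups ModularForm

open CongruenceSubgroup WeierstrassCurve Literature.NumberTheory.EllipticCurves
  Literature.NumberTheory.EllipticCurves.ModularForms
  Literature.NumberTheory.EllipticCurves.Rank1Residual

namespace Summit.BirchSwinnertonDyer.Rank1Residual.Ordinary

/-! ### §1 One level: the floor is predicted; `ord ≥ 2v`; a unit forces `v = 0` -/

section OneLevel

variable (W : WeierstrassCurve ℚ) [W.IsGloballyMinimal] {N : ℕ} (f : CuspForm (Gamma0 N) 2)
  (ℓ : ℕ) [Fact ℓ.Prime] (k : ℕ) (P : W.toAffine.Point) (F : ℕ)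

/-- **The level PREDICTS the floor: `F + 2·v_ℓ(P) = ord₃ δ̃_ℓ`** whenever the law holds at `(ℓ, k)` with
floor `F` and the mod-`3^k` Kurihara number (for some surjective logarithms) is NON-ZERO — no `#Ш_an`, no
Tamagawa number is read. [cite: Kim2022StructureSelmer, §1.4.3 (PDF p. 7)] -/
theorem floor_add_eq_zmodPowOrd_of_ne_zero (hlaw : KuriharaExactOrderAt W f ℓ k P F)
    (ψ : (q : ℕ) → (ZMod q)ˣ →* Multiplicative (ZMod (3 ^ k)))
    (hψ : ∀ q ∈ ℓ.primeFactors, Function.Surjective (ψ q))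
    (hne : haveI : NeZero ℓ := ⟨(Fact.out : ℓ.Prime).ne_zero⟩; kuriharaNumber f (3 ^ k) ℓ ψ ≠ 0) :
    haveI : NeZero ℓ := ⟨(Fact.out : ℓ.Prime).ne_zero⟩
    F + 2 * localDivExponent W 3 ℓ P = zmodPowOrd 3 k (kuriharaNumber f (3 ^ k) ℓ ψ) := by
  haveI : NeZero ℓ := ⟨(Fact.out : ℓ.Prime).ne_zero⟩
  have h := hlaw ψ hψ
  have hlt : zmodPowOrd 3 k (kuriharaNumber f (3 ^ k) ℓ ψ) < k :=
    zmodPowOrd_lt_of_ne_zero (by norm_num) hne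
  rw [h] at hlt ⊢
  omega

/-- **`2·v_ℓ(P) ≤ ord₃ δ̃_ℓ` at every NON-VANISHING level** under the law (any floor): a BSD-free necessary
condition, checkable from one Kurihara number and one point multiplication mod `ℓ`.
[cite: Kim2022StructureSelmer, §1.4.3 (PDF p. 7)] -/
theorem two_mul_localDivExponent_le_zmodPowOrd (hlaw : KuriharaExactOrderAt W f ℓ k P F)
    (ψ : (q : ℕ) → (ZMod q)ˣ →* Multiplicative (ZMod (3 ^ k)))
    (hψ : ∀ q ∈ ℓ.primeFactors, Function.Surjective (ψ q))
    (hne : haveI : NeZero ℓ := ⟨(Fact.out : ℓ.Prime).ne_zero⟩; kuriharaNumber f (3 ^ k) ℓ ψ ≠ 0) :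
    haveI : NeZero ℓ := ⟨(Fact.out : ℓ.Prime).ne_zero⟩
    2 * localDivExponent W 3 ℓ P ≤ zmodPowOrd 3 k (kuriharaNumber f (3 ^ k) ℓ ψ) := by
  have h := floor_add_eq_zmodPowOrd_of_ne_zero W f ℓ k P F hlaw ψ hψ hne
  omega

/-- **A UNIT Kurihara number forces `v_ℓ(P) = 0` (and `F = 0`)** under the law: at a cyclic Kolyvagin prime
with `v_ℓ(P) ≥ 1` (`P̄` divisible by `3` in `Ẽ(𝔽_ℓ)`), a unit `δ̃_ℓ` refutes the law at that level — the
converse of the UNIT reading, BSD-free. [cite: Kim2022StructureSelmer, §1.4.3 (PDF p. 7)] -/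
theorem localDivExponent_eq_zero_of_isUnit_kuriharaNumber (hk : 1 ≤ k)
    (hlaw : KuriharaExactOrderAt W f ℓ k P F)
    (ψ : (q : ℕ) → (ZMod q)ˣ →* Multiplicative (ZMod (3 ^ k)))
    (hψ : ∀ q ∈ ℓ.primeFactors, Function.Surjective (ψ q))
    (hu : haveI : NeZero ℓ := ⟨(Fact.out : ℓ.Prime).ne_zero⟩; IsUnit (kuriharaNumber f (3 ^ k) ℓ ψ)) :
    localDivExponent W 3 ℓ P = 0 ∧ F = 0 := by
  haveI : NeZero ℓ := ⟨(Fact.out : ℓ.Prime).ne_zero⟩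
  haveI : Nontrivial (ZMod (3 ^ k)) :=
    ZMod.nontrivial_iff.mpr (Nat.one_lt_pow (by omega) (by norm_num)).ne'
  have hne : kuriharaNumber f (3 ^ k) ℓ ψ ≠ 0 := hu.ne_zero
  have h := floor_add_eq_zmodPowOrd_of_ne_zero W f ℓ k P F hlaw ψ hψ hne
  -- a unit has `ord₃ = 0`: its `val` is prime to `3`
  have hord : zmodPowOrd 3 k (kuriharaNumber f (3 ^ k) ℓ ψ) = 0 := by
    rw [zmodPowOrd_eq_zero_iff_of_ne_zero (by norm_num) hne]
    intro hdvd
    have hcop : Nat.Coprime (kuriharaNumber f (3 ^ k) ℓ ψ).val (3 ^ k) :=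
      (ZMod.val_coe_unit_coprime hu.unit)
    have h3 : Nat.Coprime (kuriharaNumber f (3 ^ k) ℓ ψ).val 3 :=
      Nat.Coprime.coprime_dvd_right (dvd_pow_self 3 (by omega)) hcop
    exact (Nat.Prime.coprime_iff_not_dvd Nat.prime_three).mp h3.symm hdvd
  omega

end OneLevel

/-! ### §2 Two levels of one curve: `ord₁ + 2·v₂ = ord₂ + 2·v₁` -/

section TwoLevels

variable (W : WeierstrassCurve ℚ) [W.IsGloballyMinimal] {N : ℕ} (f : CuspForm (Gamma0 N) 2)
  (P : W.toAffine.Point) (F : ℕ)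

/-- **The cross-level identity.** If the law holds with the SAME floor `F` at two levels `(ℓ₁, k₁)`,
`(ℓ₂, k₂)` of one curve and both Kurihara numbers are non-zero, then
`ord₃ δ̃_{ℓ₁} + 2·v_{ℓ₂}(P) = ord₃ δ̃_{ℓ₂} + 2·v_{ℓ₁}(P)` — the floor cancels: a test of C-16 that reads no
BSD-side datum. [cite: Kim2022StructureSelmer, §1.4.3 (PDF p. 7)] -/
theorem zmodPowOrd_add_eq_of_kuriharaExactOrderAt_pair
    {ℓ₁ : ℕ} [Fact ℓ₁.Prime] {k₁ : ℕ} (h₁ : KuriharaExactOrderAt W f ℓ₁ k₁ P F)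
    (ψ₁ : (q : ℕ) → (ZMod q)ˣ →* Multiplicative (ZMod (3 ^ k₁)))
    (hψ₁ : ∀ q ∈ ℓ₁.primeFactors, Function.Surjective (ψ₁ q))
    (hne₁ : haveI : NeZero ℓ₁ := ⟨(Fact.out : ℓ₁.Prime).ne_zero⟩; kuriharaNumber f (3 ^ k₁) ℓ₁ ψ₁ ≠ 0)
    {ℓ₂ : ℕ} [Fact ℓ₂.Prime] {k₂ : ℕ} (h₂ : KuriharaExactOrderAt W f ℓ₂ k₂ P F)
    (ψ₂ : (q : ℕ) → (ZMod q)ˣ →* Multiplicative (ZMod (3 ^ k₂)))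
    (hψ₂ : ∀ q ∈ ℓ₂.primeFactors, Function.Surjective (ψ₂ q))
    (hne₂ : haveI : NeZero ℓ₂ := ⟨(Fact.out : ℓ₂.Prime).ne_zero⟩; kuriharaNumber f (3 ^ k₂) ℓ₂ ψ₂ ≠ 0) :
    haveI : NeZero ℓ₁ := ⟨(Fact.out : ℓ₁.Prime).ne_zero⟩
    haveI : NeZero ℓ₂ := ⟨(Fact.out : ℓ₂.Prime).ne_zero⟩
    zmodPowOrd 3 k₁ (kuriharaNumber f (3 ^ k₁) ℓ₁ ψ₁) + 2 * localDivExponent W 3 ℓ₂ P =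
      zmodPowOrd 3 k₂ (kuriharaNumber f (3 ^ k₂) ℓ₂ ψ₂) + 2 * localDivExponent W 3 ℓ₁ P := by
  have e₁ := floor_add_eq_zmodPowOrd_of_ne_zero W f ℓ₁ k₁ P F h₁ ψ₁ hψ₁ hne₁
  have e₂ := floor_add_eq_zmodPowOrd_of_ne_zero W f ℓ₂ k₂ P F h₂ ψ₂ hψ₂ hne₂
  omega

/-- **Contrapositive (the BSD-free kill form at fixed floor):** two non-vanishing levels of one curve with
`ord₁ + 2v₂ ≠ ord₂ + 2v₁` refute the conjunction of the two level laws, for EVERY floor `F`.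
[cite: Kim2022StructureSelmer, §1.4.3 (PDF p. 7)] -/
theorem not_kuriharaExactOrderAt_and_of_pair_violation
    {ℓ₁ : ℕ} [Fact ℓ₁.Prime] {k₁ : ℕ} (ψ₁ : (q : ℕ) → (ZMod q)ˣ →* Multiplicative (ZMod (3 ^ k₁)))
    (hψ₁ : ∀ q ∈ ℓ₁.primeFactors, Function.Surjective (ψ₁ q))
    (hne₁ : haveI : NeZero ℓ₁ := ⟨(Fact.out : ℓ₁.Prime).ne_zero⟩; kuriharaNumber f (3 ^ k₁) ℓ₁ ψ₁ ≠ 0)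
    {ℓ₂ : ℕ} [Fact ℓ₂.Prime] {k₂ : ℕ} (ψ₂ : (q : ℕ) → (ZMod q)ˣ →* Multiplicative (ZMod (3 ^ k₂)))
    (hψ₂ : ∀ q ∈ ℓ₂.primeFactors, Function.Surjective (ψ₂ q))
    (hne₂ : haveI : NeZero ℓ₂ := ⟨(Fact.out : ℓ₂.Prime).ne_zero⟩; kuriharaNumber f (3 ^ k₂) ℓ₂ ψ₂ ≠ 0)
    (hviol : haveI : NeZero ℓ₁ := ⟨(Fact.out : ℓ₁.Prime).ne_zero⟩
      haveI : NeZero ℓ₂ := ⟨(Fact.out : ℓ₂.Prime).ne_zero⟩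
      zmodPowOrd 3 k₁ (kuriharaNumber f (3 ^ k₁) ℓ₁ ψ₁) + 2 * localDivExponent W 3 ℓ₂ P ≠
        zmodPowOrd 3 k₂ (kuriharaNumber f (3 ^ k₂) ℓ₂ ψ₂) + 2 * localDivExponent W 3 ℓ₁ P) :
    ¬ (KuriharaExactOrderAt W f ℓ₁ k₁ P F ∧ KuriharaExactOrderAt W f ℓ₂ k₂ P F) := fun h =>
  hviol (zmodPowOrd_add_eq_of_kuriharaExactOrderAt_pair W f P F h.1 ψ₁ hψ₁ hne₁ h.2 ψ₂ hψ₂ hne₂)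

end TwoLevels

/-! ### §3 From the closed sentence: C-16 ⟹ the cross-level identity on every curve of its letter -/

section Closed

/-- **C-16 ⟹ on every curve of its letter, any two cyclic Kolyvagin primes `ℓ₁ ∈ 𝒫_{k₁}`, `ℓ₂ ∈ 𝒫_{k₂}`
with non-vanishing mod-`3^{k_i}` Kurihara numbers satisfy `ord₁ + 2·v_{ℓ₂}(P) = ord₂ + 2·v_{ℓ₁}(P)`**
(`hC` is the HYPOTHESIS; the floor `v₃ #Ш_an + v₃ ∏ c_q` cancels — it is quantified away through the
letter's `q`, `s`). [cite: Kim2022StructureSelmer, §1.4.3 (PDF p. 7)] -/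
theorem zmodPowOrd_add_eq_of_kuriharaExactOrderRankOne (hC : KuriharaExactOrderRankOneAtThree)
    (W : WeierstrassCurve ℚ) [W.IsElliptic] [W.IsGloballyMinimal] (hr : W.analyticRank = 1)
    (P : W.toAffine.Point) (hP : ¬ IsOfFinAddOrder P)
    (hgen : ∀ Q : W.toAffine.Point, ∃ n : ℤ, IsOfFinAddOrder (Q - n • P))
    (htors : ∀ T : W.toAffine.Point, 3 • T = 0 → T = 0) (hsurj : W.HasSurjectiveModNGaloisRep 3)
    (hgood : W.HasGoodReductionAtPrime 3) (ha1 : W.frobeniusTrace 3 ≠ 1) (ha2 : W.frobeniusTrace 3 ≠ -2)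
    (hm : ¬ O5.PointLocallyThreeDivisibleAt W 3 P) {q : ℚ} {s : ℕ} (hq : shaAn W = (q : ℂ))
    (hs : padicValRat 3 q = s) {N : ℕ} [NeZero N] (D : ModularParametrizationData W N)
    (hc : ¬ (3 : ℤ) ∣ D.maninConstant)
    (hper : ∃ u : ℚ, ‖(u : ℚ_[3])‖ = 1 ∧ W.realPeriodRat = u * plusPeriod D.f)
    {ℓ₁ : ℕ} [Fact ℓ₁.Prime] {k₁ : ℕ} (hk₁ : 1 ≤ k₁) (hℓ₁ : Kato.IsKolyvaginPrime W 3 k₁ ℓ₁)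
    (hcyc₁ : IsCyclicKolyvaginLevel W 3 ℓ₁)
    (ψ₁ : (q : ℕ) → (ZMod q)ˣ →* Multiplicative (ZMod (3 ^ k₁)))
    (hψ₁ : ∀ q ∈ ℓ₁.primeFactors, Function.Surjective (ψ₁ q))
    (hne₁ : haveI : NeZero ℓ₁ := ⟨(Fact.out : ℓ₁.Prime).ne_zero⟩; kuriharaNumber D.f (3 ^ k₁) ℓ₁ ψ₁ ≠ 0)
    {ℓ₂ : ℕ} [Fact ℓ₂.Prime] {k₂ : ℕ} (hk₂ : 1 ≤ k₂) (hℓ₂ : Kato.IsKolyvaginPrime W 3 k₂ ℓ₂)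
    (hcyc₂ : IsCyclicKolyvaginLevel W 3 ℓ₂)
    (ψ₂ : (q : ℕ) → (ZMod q)ˣ →* Multiplicative (ZMod (3 ^ k₂)))
    (hψ₂ : ∀ q ∈ ℓ₂.primeFactors, Function.Surjective (ψ₂ q))
    (hne₂ : haveI : NeZero ℓ₂ := ⟨(Fact.out : ℓ₂.Prime).ne_zero⟩; kuriharaNumber D.f (3 ^ k₂) ℓ₂ ψ₂ ≠ 0) :
    haveI : NeZero ℓ₁ := ⟨(Fact.out : ℓ₁.Prime).ne_zero⟩
    haveI : NeZero ℓ₂ := ⟨(Fact.out : ℓ₂.Prime).ne_zero⟩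
    zmodPowOrd 3 k₁ (kuriharaNumber D.f (3 ^ k₁) ℓ₁ ψ₁) + 2 * localDivExponent W 3 ℓ₂ P =
      zmodPowOrd 3 k₂ (kuriharaNumber D.f (3 ^ k₂) ℓ₂ ψ₂) + 2 * localDivExponent W 3 ℓ₁ P := by
  have h₁ := hC W hr P hP hgen htors hsurj hgood ha1 ha2 hm q s hq hs D hc hper ℓ₁ k₁ hk₁ hℓ₁ hcyc₁
  have h₂ := hC W hr P hP hgen htors hsurj hgood ha1 ha2 hm q s hq hs D hc hper ℓ₂ k₂ hk₂ hℓ₂ hcyc₂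
  exact zmodPowOrd_add_eq_of_kuriharaExactOrderAt_pair W D.f P _ h₁ ψ₁ hψ₁ hne₁ h₂ ψ₂ hψ₂ hne₂

end Closed

end Summit.BirchSwinnertonDyer.Rank1Residual.Ordinary

end
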